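import Mathlib
import Literature.AlgebraicGeometry.Resolution.AugmentationIdeal
import Literature.AlgebraicGeometry.Resolution.RegularSequenceSpread
import Summits.ResolutionOfSingularities.ResolutionOfSingularities.Theorems.WildQuotientsWildQuotientResolutionInvolutionFixedLocusRegular

/-!
# Involutions with `2` invertible on a regular ring: `R ⧸ I_ι` is a regular ring (card `mu2-strata-kl-twice`, H2 global)

(crux stmt-ResolutionOfSingularities-15640 `WildQuotients.WildQuotientResolution`, line `Sketch`,
sector `|G| = p`; RUNG V5 of `L/w45c/CHAIN.md` v8.3, brick B7/`HP₂`; res-L1-w45c-plan-1 ORDER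
2026-08-27T12:24:13Z (1) «(H2-glob)(a) `isRegularRing_quotient_augIdeal`», res-type-036 12:02:54Z
«H2 NEEDED — abstract». [OURS · L1 W4.5c] — NOT a statement of any manuscript; replaces the role
of no printed item. Prover res-L1-w45c-stub-3.)

`InvolutionExit.isRegularRing_quotient_augIdeal`: for a regular ring `R` (Noetherian, all
localisations regular) and an involution `ι` with `2 ∈ Rˣ`, the fixed-locus ring `R ⧸ I_ι` is a
regular ring. Regularity of a quotient is local at the maximal ideals `P ⊇ I_ι`
(Literature `isRegularRing_quotient_of_localization_maximal`); `ι` fixes such a `P`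
(`ι x = x + (ι x − x)`), so it localises to an involution `τ` of `R_P` over `ι`
(`IsLocalization.ringEquivOfRingEquiv`), with `I_ι · R_P = I_τ ≤ P R_P` (Literature
`map_augIdeal_of_isLocalization`), and `R_P ⧸ I_τ` is regular local by the local theorem H2
(`isRegularLocalRing_quotient_augIdeal`, p530611).
-/

-- single-problem summit: the doubled namespace component `ResolutionOfSingularities` is forced
set_option linter.dupNamespace false

noncomputable section

namespace Summit.ResolutionOfSingularities.ResolutionOfSingularities.Theorems.WildQuotientResolution.InvolutionExit

open IsLocalRing
open Literature.AlgebraicGeometry.Resolution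

variable {R : Type} [CommRing R] (ι : R ≃+* R) (hι : ∀ x, ι (ι x) = x)

/-- A prime (indeed any ideal) containing the augmentation ideal is `ι`-stable:
`ι x ∈ P ↔ x ∈ P`. [folklore] -/
theorem apply_mem_iff_of_augIdeal_le {P : Ideal R} (hIP : augIdeal ι ≤ P) (x : R) :
    ι x ∈ P ↔ x ∈ P := by
  have h1 : ι x - x ∈ P := hIP (sub_mem_augIdeal ι x)
  constructor
  · intro h
    have : x = ι x - (ι x - x) := by ring
    rw [this]; exact sub_mem h h1
  · intro h
    have : ι x = x + (ι x - x) := by ring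
    rw [this]; exact add_mem h h1

include hι in
/-- The complement of an ideal containing `I_ι` is mapped onto itself by `ι`. [folklore] -/
theorem map_primeCompl_eq {P : Ideal R} [P.IsPrime] (hIP : augIdeal ι ≤ P) :
    P.primeCompl.map ι.toMonoidHom = P.primeCompl := by
  ext x
  simp only [Submonoid.mem_map, Ideal.mem_primeCompl_iff]
  constructor
  · rintro ⟨y, hy, rfl⟩
    exact fun h => hy ((apply_mem_iff_of_augIdeal_le ι hIP y).mp h)
  · intro hx
    exact ⟨ι x, fun h => hx ((apply_mem_iff_of_augIdeal_le ι hIP x).mp h), hι x⟩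

include hι in
/-- **H2 (global) — the fixed-locus ring of a tame involution on a regular ring is regular**: for
a regular ring `R` and an involution `ι : R ≃+* R` with `2` invertible, `R ⧸ I_ι` is a regular ring.
[OURS · L1 W4.5c, card `mu2-strata-kl-twice` H2] [folklore] -/
theorem isRegularRing_quotient_augIdeal [IsRegularRing R] (h2 : IsUnit (2 : R)) :
    IsRegularRing (R ⧸ augIdeal ι) := by
  refine isRegularRing_quotient_of_localization_maximal (augIdeal ι) fun P hP hIP => ?_
  set L := Localization.AtPrime P with hL
  have H : P.primeCompl.map ι.toMonoidHom = P.primeCompl := map_primeCompl_eq ι hι hIP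
  let τ : L ≃+* L := IsLocalization.ringEquivOfRingEquiv L L ι H
  have hτalg : ∀ b : R, τ (algebraMap R L b) = algebraMap R L (ι b) := fun b =>
    IsLocalization.ringEquivOfRingEquiv_eq H b
  have hττ : ∀ z : L, τ (τ z) = z := by
    have hcomp : (τ : L →+* L).comp (τ : L →+* L) = RingHom.id L := by
      refine IsLocalization.ringHom_ext P.primeCompl ?_
      ext b
      simp only [RingHom.comp_apply, RingHom.coe_coe, RingHom.id_apply]
      rw [hτalg, hτalg, hι]
    intro z
    exact DFunLike.congr_fun hcomp z
  have h2L : IsUnit (2 : L) := by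
    have h := h2.map (algebraMap R L)
    rwa [map_ofNat] at h
  have haug : (augIdeal ι).map (algebraMap R L) = augIdeal τ :=
    map_augIdeal_of_isLocalization P.primeCompl ι τ hτalg
  have hle : augIdeal τ ≤ maximalIdeal L := by
    rw [← haug, ← Localization.AtPrime.map_eq_maximalIdeal]
    exact Ideal.map_mono hIP
  have hreg : IsRegularLocalRing (L ⧸ augIdeal τ) :=
    isRegularLocalRing_quotient_augIdeal τ hττ h2L hle
  refine ⟨L, inferInstance, inferInstance, inferInstance, ?_⟩
  rw [haug]
  exact hreg

end Summit.ResolutionOfSingularities.ResolutionOfSingularities.Theorems.WildQuotientResolution.InvolutionExit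

end
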